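import Summits.QuantumFields.YangMills.Theorems.BalabanUVNodesN07AtRecord12Sides
import Literature.MathematicalPhysics.QuantumFieldTheory.Balaban1983to89.Node00.CarriersZSectG

/-!
# BalabanUVNodes ∕ N07 ([Balaban1985Variational], `Dag.B11_main`) AT THE TRIPLY-REFINED RESIDUAL LAYER `(ζ.withSectEG E G).pinCrit` — Sect. E presented (p4, p6 theorems,
# node00-def-B11), Sect. G presented (p9 a theorem, this seat's `Node00/CarriersZSectG`) AND «critical» pinned (`hcrit` a theorem, this lineage's `Node00/CriticalOfRecord`):
# the N07 closers of record re-run there in the three currencies of the lineage (print's Prop-7 DAG · the repaired∕printed tower κ₀ = 1 · seat -c's Sect-F chain), their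
# Stage-12 ∃-consumers, the composable face for the K1′ knit, and the census (the `ζ.R` junk channel survives all three refinements; the curve form of «critical» off 𝔅_k(V))

Track A of `YM-PLAN.md` (cell `pub-ymgap`, HUMAN RULING D-0062), DAG node **N07** = [Balaban1985Variational] T. Bałaban, *The variational problem and background fields in
renormalization group method for lattice gauge theories*, Commun. Math. Phys. **102** (1985) 277–309, Theorem 1 p. 279 and Propositions 2–9 pp. 281–309; node sentence
`Dag.B11_main`, leaf `DagBinding.B11Leaf`.  Seat `pub-ymgap-dag-n07-e` (FAN-OUT v1.1 §N07 row s3 «REPAIRED-TOWER CURRENCY»), gen 4, ninth module of the lineage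
(p454423 · p456450 · p458026 · p458798 · p464601 · p465289 · p468384 · p470343 · `Node00/CarriersZSectG`).

WHY.  After g2 ∕ g3 the N07 node sentence at the doubly-pinned layer `(ζ.withSectE E).pinCrit` displayed ONLY printed statements — Props 2, 3, 5 (over def-B11's Sect.-E family),
Prop 8 + Sect. F (+ Prop 7 in the DAG currency) over the Props 7–8 family of record, AND Prop. 9 over the free residual family `ζ.famAn` — plus the located bridge steps and the
constant relations.  `Node00/CarriersZSectG` (this seat, filed with this module) presents `ζ.famAn` through n07-b's Sect. E–G model datum at NODE 00's objects, making p9 a THEOREM BY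
NAME (`prop9_Z11OfRecord_withSectG ∕ _withSectEG`, n07-a's `B11LeafKnitProp9.prop9_conjunct_of_model`) under `B11Prop9Model`'s declared reading (R7).  THIS MODULE re-runs the
lineage's closers at the TRIPLY-refined layer `(ζ.withSectEG E G).pinCrit`, where p4, p6, p9 AND `hcrit` are theorems and `hloc` is absent: the displayed inputs of every N07
sentence below are Props 2, 3, 5 (Sect.-E family) and Prop 8 + Sect. F (resp. Prop 7, resp. seat -c's chain displays) over `famXOfRecord F N (ζ.withSectEG E G).pinCrit`, the bridge
data with its two printed clauses, the capped existence leaves, and the constant ∕ positivity relations — NOTHING ELSE of [Balaban1985Variational].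

WHAT (theorems only; every proof is a lineage theorem of record applied at `ζ := ζ.withSectEG E G` with p4 ∕ p6 ∕ p9 supplied by `Node00.prop4_∕prop6_∕prop9_Z11OfRecord_withSectEG`
at `ζ.pinCrit` — the three refinements commute definitionally, `Node00.ResidZ.pinCrit_withSectEG`).
§0 `withSectEG_pinCrit_faces` — what the layer's four families ARE (`rfl` ×4).
§1 PRINT's PROP-7 DAG: ★ `b11Leaf_Z11OfRecord_withSectEG_pinCrit_of_parts` (the leaf from SIX printed statements: Props 2, 3, 5 ∣ Props 7, 8, Sect. F), its Stage-12 ∃-consumer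
   `exists_record₁₂CB10YZW_b11_main_withSectEG_pinCrit_of_parts` (REAL runs modulo K0′), the composable face `b11_main_at_view₁₂B10YZW_withSectEG_pinCrit_of_parts` (what n24-c's
   MODULE 29 applies at the ONE world of the four-pin view with `ζ := (ζ₀.withSectEG E G).pinCrit` CHOSEN) and the K1′ ∃-form `exists_isRecordOfRecord₁₂C_b11_main_withSectEG_pinCrit_of_parts`.
§2 THE PRINTED TOWER (κ₀ = 1), bridge displayed by its two printed clauses: ★ `b11Leaf_Z11OfRecord_withSectEG_pinCrit_of_towerT_parts_kappa_one` (Props 2, 3, 5 ∣ 8, Sect. F +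
   `βr bg hbg14 gaugeFix orbit16 leaves` + constants; Theorem 1 AND Proposition 7 DERIVED by the repaired Sect.-A induction of record), its ∃-consumer and K1′ ∃-form.
§3 SEAT -c's CHAIN CURRENCY of Sect. F: `b11Leaf_Z11OfRecord_withSectEG_pinCrit_of_prop7_chain` (Props 2, 3, 5, 7 + `ChainLeaves`∕`UnitLeaves` displays + the three located leaves) and
   its ∃-consumer.
§4 CENSUS ∕ HONESTY: `exists_withSectEG_pinCrit_not_b11Leaf` (the ∀-form junk channel through the residual regularity data `ζ.R` SURVIVES all three refinements — F8, whose
   gauge-invariant pin node00-def-B11 g4 is typing as `Node00/CarriersZRegPin`, INTENT-1 2026-08-27), and the owed honesty sentence of ref-C READ-121 NOTE 1 on this lineage's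
   criticality predicate: `isCritOfRecord_of_iter_ne` — the curve form `Node00.IsCritOfRecord F N K k V U` is VACUOUSLY TRUE off the constraint manifold 𝔅_k(V) (no admissible
   curve), harmless because every consumer (`B11.VarProblemX` laws, Props 7–8, Sect. F) reads it together with `InB V U`.
HONEST FRAMING: kernel bookkeeping BY NAME over landed modules; NO estimate of [Balaban1985Variational] proved or asserted; every printed statement the closers consume is DISPLAYED
as a hypothesis (Props 2, 3, 5, 7∕8, Sect. F ∕ the chain displays) or is a theorem of a named module under its declared reading (p4, p6: def-B11's Sect.-E presentation; p9:
`CarriersZSectG`, reading (R7); `hcrit`: `CriticalOfRecord`; t1 ∕ p7: the tower of record); N07 NOT discharged; COUNT-NEUTRAL (5∕27 unmoved); residual for a count line BY NAME after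
this module: the printed statements at objects (Props 2, 3, 5 over the Sect.-E data, Prop 8 + Sect. F ∕ Prop 7 over the family of record — T3-class content), the `ζ.R` pin (F8), the
operator DATA inside the Sect.-E ∕ Sect.-G data, K0′ (stmt-QuantumFields-19902); one finite T⁴ programme at fixed ε, Bałaban AS PRINTED — NOT continuum ∕ ℝ⁴ ∕ OS ∕ mass-gap ∕ Clay.
No `sorry`, no new `def`, no `instance`, no `notation`.  Filed `--supports stmt-QuantumFields-19903 --as helper` (K1′ `StabilityBAtRecordR12e`).
-/

noncomputable section

namespace Summit.QuantumFields.YangMills.BalabanUVNodes.N07AtRecordSectGPinned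

open Literature.MathematicalPhysics.QuantumFieldTheory.Balaban1983to89
open Literature.MathematicalPhysics.QuantumFieldTheory.Balaban1983to89.T4Continuum (T4Family FiniteEpsData)
open Literature.MathematicalPhysics.QuantumFieldTheory.Balaban1983to89.DagBinding
open Literature.MathematicalPhysics.QuantumFieldTheory.Balaban1983to89.Node00
open Literature.MathematicalPhysics.QuantumFieldTheory.Balaban1983to89.B12GaugeOrbits021 (OrbitRel)
open Literature.MathematicalPhysics.QuantumFieldTheory.Balaban1983to89.B11Prop7Assembly (Bridge ExistenceLeavesCap)
open Literature.MathematicalPhysics.QuantumFieldTheory.Balaban1983to89.B11SectFAssembly (CubeData Leaves tinv)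
open Literature.MathematicalPhysics.QuantumFieldTheory.Balaban1983to89.B11SectFReg165Assembly (ChainData UnitData ChainLeaves UnitLeaves)
open Literature.MathematicalPhysics.QuantumFieldTheory.Balaban1983to89.B11Holder9 (HolderClause)
open YMDAG.UVSplit (Datum)
open Summit.QuantumFields.YangMills.BalabanUVNodes.N07RestrictionLawAtObjects (b11Leaf_Z11OfRecord_of_parts_noLoc)
open Summit.QuantumFields.YangMills.BalabanUVNodes.N07AtRecord12 (b11_main_at_view₁₂B10YZW_of_leaf exists_record₁₂CB10YZW_b11_main_of_leaf
  exists_isRecordOfRecord₁₂C_b11_main_of_leaf)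
open Summit.QuantumFields.YangMills.BalabanUVNodes.N07AtRecord12Sides (b11Leaf_Z11OfRecord_withSectE_pinCrit_of_towerT_parts_kappa_one_of_gaugeFix_orbit16
  b11Leaf_Z11OfRecord_pinCrit_of_prop7_chain)
open scoped Matrix.Norms.L2Operator

variable {N : ℕ} [NeZero N] {F : T4Family} {w : WorldP}
variable {L : ℝ} {η : ZIdx → ℝ} [Fact (0 < L)] [∀ i, Fact (0 < η i)] {β : ZIdx → Type} [∀ i, Fintype (β i)]
variable {𝒴 𝒵 : ZIdx → Type} [∀ i, NormedAddCommGroup (𝒴 i)] [∀ i, NormedSpace ℂ (𝒴 i)] [∀ i, CompleteSpace (𝒴 i)]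
  [∀ i, NormedAddCommGroup (𝒵 i)] [∀ i, NormedSpace ℂ (𝒵 i)] [∀ i, CompleteSpace (𝒵 i)]

/-! ## §0 The triply-refined layer: what its four families are -/

/-- The three refinements touch DISJOINT fields: at `(ζ.withSectEG E G).pinCrit` the Props 2–6 family is def-B11's Sect.-E family, the Prop. 9 family is the Sect.-G model family of
`G`, the criticality slot is the predicate of record, and the regularity data of (9)–(10) are STILL the residual `ζ.R` (all `rfl`). [cite: Balaban1985Variational, Props 2–9 pp.281–309, (9)–(10) p.279 (bookkeeping)] -/
theorem withSectEG_pinCrit_faces (ζ : ResidZ F N) (E : SectEPres F N L η β ζ) (G : SectGPres F N 𝒴 𝒵 ζ) :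
    ((ζ.withSectEG E G).pinCrit).famLG = (fun i => (E.D i).toLGData (E.R i) ζ.C₁) ∧ ((ζ.withSectEG E G).pinCrit).famAn = (fun i => (G.D i).toAnData) ∧
      (∀ i : ZIdx, ((ζ.withSectEG E G).pinCrit).IsCrit i = IsCritOfRecord F N i.K i.k) ∧ ((ζ.withSectEG E G).pinCrit).R = ζ.R :=
  ⟨rfl, rfl, fun _ => rfl, rfl⟩

/-! ## §1 Print's Prop-7 DAG at the triply-refined layer: the leaf from SIX printed statements, its Stage-12 consumer, the K1′ faces -/

section Prop7Dag

variable (ζ : ResidZ F N) (E : SectEPres F N L η β ζ) (G : SectGPres F N 𝒴 𝒵 ζ)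

/-- ★ **THE [B11] LEAF AT THE TRIPLY-REFINED BUNDLE OF RECORD `Z11OfRecord F N (ζ.withSectEG E G).pinCrit` FROM SIX PRINTED STATEMENTS — Props 2, 3, 5 (over the Sect.-E family),
Props 7, 8, Sect. F (over the Props 7–8 family of record, «critical» = print's) — and the positivity of the letters; NOTHING ELSE**: `t1` by p. 304's assembly (g0's
`b11Leaf_Z11OfRecord_of_parts_noLoc`, `hcrit := Node00.hcrit_pinCrit`, no `hloc`), p4 and p6 by node00-def-B11's Sect.-E theorems, p9 by `Node00.prop9_Z11OfRecord_withSectEG`.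
[cite: Balaban1985Variational, Thm 1 p.279, Props 2–9 pp.281–309] -/
theorem b11Leaf_Z11OfRecord_withSectEG_pinCrit_of_parts
    (hC₄ : 0 < E.C₄) (ha₃ : 0 < E.a₃) (hα : 0 < E.α) (hB₀ : 0 < ζ.B₀) (hB₃ : 0 < ζ.B₃) (hC₁ : 0 < ζ.C₁)
    (p2 : B11.Prop2Printed ζ.B₁ ζ.B₃ ζ.C₁ ζ.c₁ (ζ.withSectE E).famLG) (p3 : B11.Prop3Printed ζ.C₁ ζ.B₃ ζ.C₂ ζ.C₃ ζ.B₀ ζ.c1h ζ.c₄ ζ.δ₀ (ζ.withSectE E).famLG)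
    (p5 : B11.Prop5Printed ζ.B₁ ζ.B₃ ζ.C₁ (ζ.withSectE E).famLG)
    (p7 : B11.Prop7Printed ζ.B₃ ζ.C₁ (famXOfRecord F N (ζ.withSectEG E G).pinCrit)) (p8 : B11.Prop8Printed ζ.B₃ (famXOfRecord F N (ζ.withSectEG E G).pinCrit))
    (sF : B11.SectFPrinted ζ.B₃ (famXOfRecord F N (ζ.withSectEG E G).pinCrit)) :
    B11Leaf (Z11OfRecord F N (ζ.withSectEG E G).pinCrit) :=
  b11Leaf_Z11OfRecord_of_parts_noLoc (ζ.withSectEG E G).pinCrit hB₃ hC₁ (hcrit_pinCrit _) p2 p3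
    (prop4_Z11OfRecord_withSectEG ζ.pinCrit E.onPinCrit G.onPinCrit hC₄ ha₃ hB₃ hα hC₁) p5
    (prop6_Z11OfRecord_withSectEG ζ.pinCrit E.onPinCrit G.onPinCrit hB₀ hC₄ ha₃ hB₃ hα hC₁) p7 p8 sF
    (prop9_Z11OfRecord_withSectEG ζ.pinCrit E.onPinCrit G.onPinCrit)

/-- **ITS STAGE-12 CONSUMER**: the six printed statements at `(ζ.withSectEG E G).pinCrit` ⇒ N07 HOLDS at every run of a ₁₂CB10YZW record over `datumOfRecord₁₂ θ h` presented with that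
layer — every admissible Stage-12 `θ` with its provisos and `γ > 0` (REAL runs modulo K0′; ∃-currency at a NAMED layer; junk in-edges at the presenting world; NOT a discharge).
[cite: Balaban1985Variational, Thm 1 p.279, Props 2–9 pp.281–309] -/
theorem exists_record₁₂CB10YZW_b11_main_withSectEG_pinCrit_of_parts (θ : Stage12Params F N) (h : θ.Provisos₁₂ F N) (hθ : θ.Admissible F N) (hγ : 0 < θ.γ)
    (Mstar : ℕ) (ops : OpsY N θ.toStage3Params Mstar) (lamW : ResidW F N)
    (hC₄ : 0 < E.C₄) (ha₃ : 0 < E.a₃) (hα : 0 < E.α) (hB₀ : 0 < ζ.B₀) (hB₃ : 0 < ζ.B₃) (hC₁ : 0 < ζ.C₁)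
    (p2 : B11.Prop2Printed ζ.B₁ ζ.B₃ ζ.C₁ ζ.c₁ (ζ.withSectE E).famLG) (p3 : B11.Prop3Printed ζ.C₁ ζ.B₃ ζ.C₂ ζ.C₃ ζ.B₀ ζ.c1h ζ.c₄ ζ.δ₀ (ζ.withSectE E).famLG)
    (p5 : B11.Prop5Printed ζ.B₁ ζ.B₃ ζ.C₁ (ζ.withSectE E).famLG)
    (p7 : B11.Prop7Printed ζ.B₃ ζ.C₁ (famXOfRecord F N (ζ.withSectEG E G).pinCrit)) (p8 : B11.Prop8Printed ζ.B₃ (famXOfRecord F N (ζ.withSectEG E G).pinCrit))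
    (sF : B11.SectFPrinted ζ.B₃ (famXOfRecord F N (ζ.withSectEG E G).pinCrit)) :
    ∃ w : WorldP, IsRecordOfRecord₁₂CB10YZW F N (datumOfRecord₁₂ F N θ h) w ∧ ∀ P : B12.RunParams, Dag.B11_main (leavesP w P) :=
  exists_record₁₂CB10YZW_b11_main_of_leaf θ h hθ hγ Mstar ops _ lamW
    (b11Leaf_Z11OfRecord_withSectEG_pinCrit_of_parts ζ E G hC₄ ha₃ hα hB₀ hB₃ hC₁ p2 p3 p5 p7 p8 sF)

/-- **THE COMPOSABLE FACE FOR THE K1′ KNIT, TRIPLY-REFINED LAYER CHOSEN**: for ANY world bound to the four-pin Stage-12 view presenting `(ζ.withSectEG E G).pinCrit` as its [B11] layer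
(`w.up P = upOfRecord₅C (θ.view₁₂B10YZW Mstar ops ((ζ.withSectEG E G).pinCrit) lamW) P`), the six printed statements give `Dag.B11_main` at every run — what n24-c's MODULE 29 recipe
(«N07 [B11] leaf at the four-pin view with `Z11OfRecord ζ` CHOSEN») applies with THIS choice of `ζ`. [cite: Balaban1985Variational, Thm 1 p.279, Props 2–9 pp.281–309 (bookkeeping: the node at the four-pin view)] -/
theorem b11_main_at_view₁₂B10YZW_withSectEG_pinCrit_of_parts (θ : Stage12Params F N) (Mstar : ℕ) (ops : OpsY N θ.toStage3Params Mstar) (lamW : ResidW F N)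
    (hup : ∀ P, w.up P = upOfRecord₅C F N (θ.view₁₂B10YZW F N Mstar ops ((ζ.withSectEG E G).pinCrit) lamW) P)
    (hC₄ : 0 < E.C₄) (ha₃ : 0 < E.a₃) (hα : 0 < E.α) (hB₀ : 0 < ζ.B₀) (hB₃ : 0 < ζ.B₃) (hC₁ : 0 < ζ.C₁)
    (p2 : B11.Prop2Printed ζ.B₁ ζ.B₃ ζ.C₁ ζ.c₁ (ζ.withSectE E).famLG) (p3 : B11.Prop3Printed ζ.C₁ ζ.B₃ ζ.C₂ ζ.C₃ ζ.B₀ ζ.c1h ζ.c₄ ζ.δ₀ (ζ.withSectE E).famLG)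
    (p5 : B11.Prop5Printed ζ.B₁ ζ.B₃ ζ.C₁ (ζ.withSectE E).famLG)
    (p7 : B11.Prop7Printed ζ.B₃ ζ.C₁ (famXOfRecord F N (ζ.withSectEG E G).pinCrit)) (p8 : B11.Prop8Printed ζ.B₃ (famXOfRecord F N (ζ.withSectEG E G).pinCrit))
    (sF : B11.SectFPrinted ζ.B₃ (famXOfRecord F N (ζ.withSectEG E G).pinCrit)) (P : B12.RunParams) :
    Dag.B11_main (leavesP w P) :=
  b11_main_at_view₁₂B10YZW_of_leaf θ Mstar ops _ lamW hup (b11Leaf_Z11OfRecord_withSectEG_pinCrit_of_parts ζ E G hC₄ ha₃ hα hB₀ hB₃ hC₁ p2 p3 p5 p7 p8 sF) P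

omit [NeZero N] in
/-- **THE K1′ ∃-FORM AT THE TRIPLY-REFINED LAYER (N07's conjunct)**: K0′ at the family `F` (the Stage-12 record class inhabited, HYPOTHESIS) + the six printed statements at
`(ζ.withSectEG E G).pinCrit` ⇒ SOME ₁₂C record of the given datum, its world re-bound by the four-pin view presenting that layer, is a ₁₂CB10YZW record carrying `Dag.B11_main` at
every run (g3's `exists_isRecordOfRecord₁₂C_b11_main_of_leaf`).  N07 ALONE; NOT a discharge. [cite: Balaban1985Variational, Thm 1 p.279, Props 2–9 pp.281–309; Balaban1989LargeFieldII, Thm 1 + (0.1) pp.355–356 (bookkeeping)] -/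
theorem exists_isRecordOfRecord₁₂C_b11_main_withSectEG_pinCrit_of_parts [NeZero N] (hK0 : ∃ (D : Datum F N) (w : WorldP), IsRecordOfRecord₁₂C F N D w)
    (hC₄ : 0 < E.C₄) (ha₃ : 0 < E.a₃) (hα : 0 < E.α) (hB₀ : 0 < ζ.B₀) (hB₃ : 0 < ζ.B₃) (hC₁ : 0 < ζ.C₁)
    (p2 : B11.Prop2Printed ζ.B₁ ζ.B₃ ζ.C₁ ζ.c₁ (ζ.withSectE E).famLG) (p3 : B11.Prop3Printed ζ.C₁ ζ.B₃ ζ.C₂ ζ.C₃ ζ.B₀ ζ.c1h ζ.c₄ ζ.δ₀ (ζ.withSectE E).famLG)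
    (p5 : B11.Prop5Printed ζ.B₁ ζ.B₃ ζ.C₁ (ζ.withSectE E).famLG)
    (p7 : B11.Prop7Printed ζ.B₃ ζ.C₁ (famXOfRecord F N (ζ.withSectEG E G).pinCrit)) (p8 : B11.Prop8Printed ζ.B₃ (famXOfRecord F N (ζ.withSectEG E G).pinCrit))
    (sF : B11.SectFPrinted ζ.B₃ (famXOfRecord F N (ζ.withSectEG E G).pinCrit)) :
    ∃ (D : Datum F N) (w : WorldP), IsRecordOfRecord₁₂C F N D w ∧ IsRecordOfRecord₁₂CB10YZW F N D w ∧ ∀ P : B12.RunParams, Dag.B11_main (leavesP w P) :=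
  exists_isRecordOfRecord₁₂C_b11_main_of_leaf F hK0 _ (b11Leaf_Z11OfRecord_withSectEG_pinCrit_of_parts ζ E G hC₄ ha₃ hα hB₀ hB₃ hC₁ p2 p3 p5 p7 p8 sF)

end Prop7Dag

/-! ## §2 The printed tower (κ₀ = 1) at the triply-refined layer: Theorem 1 and Proposition 7 derived; Props 2, 3, 5, 8, Sect. F, the bridge's two printed clauses, the leaves, the constants displayed -/

section Tower

variable (ζ : ResidZ F N) (E : SectEPres F N L η β ζ) (G : SectGPres F N 𝒴 𝒵 ζ)

/-- ★ **THE PRINTED TOWER (κ₀ = 1) AT THE TRIPLY-REFINED LAYER — THE [B11] LEAF FROM PROPS 2, 3, 5, 8, SECT. F, THE BRIDGE DATA WITH ITS TWO PRINTED CLAUSES, THE CAPPED EXISTENCE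
LEAVES AND THE CONSTANT RELATIONS; NOTHING ELSE**: Theorem 1 AND Proposition 7 DERIVED by the repaired Sect.-A induction of record (this lineage's
`b11Leaf_Z11OfRecord_withSectE_pinCrit_of_towerT_parts_kappa_one_of_gaugeFix_orbit16`, g3, at `ζ := ζ.withSectG G` — p458798 ∕ p455032 ∕ p458026 underneath), p4 ∕ p6 by
node00-def-B11's Sect.-E theorems, p9 by `Node00.prop9_Z11OfRecord_withSectG`, `hcrit` by `Node00.hcrit_pinCrit`, `hloc` absent, the bridge laws `symm`∕`trans` theorems at objects.
Displayed: the bridge DATA `βr`, `bg` with (14) at the bridge (`hbg14`), the printed clauses `gaugeFix` ((18) p. 280; «critical» = `Node00.IsCritOfRecord`) and `orbit16` ((16)), the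
capped existence leaves ((112)–(142)), `B₀ ≤ 4B₁`, `B₃ ≥ 1`, `C₁ ≥ L³`, the Sect.-E letters' positivity, Props 2, 3, 5 over the Sect.-E family, Prop 8 + Sect. F over the Props 7–8
family at the ONE constant `ζ.B₃`.  NOT a discharge. [cite: Balaban1985Variational, Thm 1 p.279, Sect. A (11)–(18) pp.279–280, Props 2–9 pp.281–309] -/
theorem b11Leaf_Z11OfRecord_withSectEG_pinCrit_of_towerT_parts_kappa_one (hC₄ : 0 < E.C₄) (ha₃ : 0 < E.a₃) (hα : 0 < E.α)
    (βr : ∀ i : ZIdx, Bridge (famXOfRecord F N (ζ.withSectEG E G).pinCrit i) ((ζ.withSectE E).famLG i))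
    (bg : ∀ i : ZIdx, GaugeField (F.P i.K) 0 (SU N) → ((ζ.withSectE E).famLG i).Cfg) {O₁ O₂ e₅ : ℝ}
    (hbg14 : ∀ (i : ZIdx) (ε : ℝ) (V : GaugeField (F.P i.K) i.k (SU N)) (U : GaugeField (F.P i.K) 0 (SU N)),
      InUkClassB11 F N i.K i.k (ζ.C₁ * ζ.B₃ * ε) U → Averaging.iter (avOfRecord F N i.K) i.k U = V →
        ((ζ.withSectE E).famLG i).Sat14 (ζ.C₁ * ζ.B₃ * ε) (ζ.C₁ * ε) ((βr i).bdry V) (bg i U))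
    (gaugeFix : ∀ (i : ZIdx) (ε₀ ε₁ : ℝ) (V : GaugeField (F.P i.K) i.k (SU N)) (U₀ : ((ζ.withSectE E).famLG i).Cfg) (U : GaugeField (F.P i.K) 0 (SU N)),
      ((ζ.withSectE E).famLG i).Sat14 (ζ.C₁ * ζ.B₃ * ε₁) (ζ.C₁ * ε₁) ((βr i).bdry V) U₀ → InUkClassB11 F N i.K i.k ε₀ U →
        Averaging.iter (avOfRecord F N i.K) i.k U = V →
          ∃ U' : ((ζ.withSectE E).famLG i).Pert, ((ζ.withSectE E).famLG i).In18 ε₀ ((βr i).bdry V) U₀ U' ∧ OrbitRel i.k U ((βr i).emb U₀ U') ∧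
            (IsCritOfRecord F N i.K i.k V U → ((ζ.withSectE E).famLG i).Crit ((βr i).bdry V) U₀ U'))
    (orbit16 : ∀ (i : ZIdx) (U₀ : ((ζ.withSectE E).famLG i).Cfg) (U₁ : ((ζ.withSectE E).famLG i).Pert) (u u' : ((ζ.withSectE E).famLG i).GT),
      ((ζ.withSectE E).famLG i).Restricted U₀ u → ((ζ.withSectE E).famLG i).Restricted U₀ u' →
        OrbitRel i.k ((βr i).emb U₀ (((ζ.withSectE E).famLG i).toAxial U₀ U₁ u)) ((βr i).emb U₀ (((ζ.withSectE E).famLG i).toAxial U₀ U₁ u')))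
    (leaves : ∀ i, ExistenceLeavesCap (βr i) ζ.B₀ ζ.B₃ ζ.C₁ O₁ O₂ e₅)
    (hB₀ : 0 < ζ.B₀) (hB₁ : 0 < ζ.B₁) (hB₃ : 1 ≤ ζ.B₃) (hC₁L : (F.L : ℝ) ^ 3 ≤ ζ.C₁) (hB₀B₁ : ζ.B₀ ≤ 4 * ζ.B₁)
    (hc₁ : 0 < ζ.c₁) (hO₁ : 0 < O₁) (hO₂ : 0 < O₂) (he₅ : 0 < e₅)
    (p2 : B11.Prop2Printed ζ.B₁ ζ.B₃ ζ.C₁ ζ.c₁ (ζ.withSectE E).famLG) (p3 : B11.Prop3Printed ζ.C₁ ζ.B₃ ζ.C₂ ζ.C₃ ζ.B₀ ζ.c1h ζ.c₄ ζ.δ₀ (ζ.withSectE E).famLG)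
    (p5 : B11.Prop5Printed ζ.B₁ ζ.B₃ ζ.C₁ (ζ.withSectE E).famLG)
    (p8 : B11.Prop8Printed ζ.B₃ (famXOfRecord F N (ζ.withSectEG E G).pinCrit)) (sF : B11.SectFPrinted ζ.B₃ (famXOfRecord F N (ζ.withSectEG E G).pinCrit)) :
    B11Leaf (Z11OfRecord F N (ζ.withSectEG E G).pinCrit) :=
  b11Leaf_Z11OfRecord_withSectE_pinCrit_of_towerT_parts_kappa_one_of_gaugeFix_orbit16 (ζ.withSectG G) (E.onWithSectG G) hC₄ ha₃ hα βr bg hbg14 gaugeFix orbit16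
    leaves hB₀ hB₁ hB₃ hC₁L hB₀B₁ hc₁ hO₁ hO₂ he₅ p2 p3 p5 p8 sF (prop9_Z11OfRecord_withSectG ζ G)

/-- **… AND ITS STAGE-12 CONSUMER**: the same displayed inputs ⇒ N07 HOLDS at every run of a ₁₂CB10YZW record over `datumOfRecord₁₂ θ h` presented with `(ζ.withSectEG E G).pinCrit` — THE
N07 NODE SENTENCE OF RECORD IN THE s3 (REPAIRED ∕ PRINTED TOWER) CURRENCY, now displaying printed statements Props 2, 3, 5, 8, Sect. F ONLY (+ the located bridge steps + constants), about
REAL Stage-12 runs modulo K0′; NOT a discharge. [cite: Balaban1985Variational, Thm 1 p.279, Sect. A (11)–(18) pp.279–280, Props 2–9 pp.281–309] -/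
theorem exists_record₁₂CB10YZW_b11_main_withSectEG_pinCrit_of_towerT_parts_kappa_one (θ : Stage12Params F N) (h : θ.Provisos₁₂ F N) (hθ : θ.Admissible F N)
    (hγ : 0 < θ.γ) (Mstar : ℕ) (ops : OpsY N θ.toStage3Params Mstar) (lamW : ResidW F N) (hC₄ : 0 < E.C₄) (ha₃ : 0 < E.a₃) (hα : 0 < E.α)
    (βr : ∀ i : ZIdx, Bridge (famXOfRecord F N (ζ.withSectEG E G).pinCrit i) ((ζ.withSectE E).famLG i))
    (bg : ∀ i : ZIdx, GaugeField (F.P i.K) 0 (SU N) → ((ζ.withSectE E).famLG i).Cfg) {O₁ O₂ e₅ : ℝ}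
    (hbg14 : ∀ (i : ZIdx) (ε : ℝ) (V : GaugeField (F.P i.K) i.k (SU N)) (U : GaugeField (F.P i.K) 0 (SU N)),
      InUkClassB11 F N i.K i.k (ζ.C₁ * ζ.B₃ * ε) U → Averaging.iter (avOfRecord F N i.K) i.k U = V →
        ((ζ.withSectE E).famLG i).Sat14 (ζ.C₁ * ζ.B₃ * ε) (ζ.C₁ * ε) ((βr i).bdry V) (bg i U))
    (gaugeFix : ∀ (i : ZIdx) (ε₀ ε₁ : ℝ) (V : GaugeField (F.P i.K) i.k (SU N)) (U₀ : ((ζ.withSectE E).famLG i).Cfg) (U : GaugeField (F.P i.K) 0 (SU N)),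
      ((ζ.withSectE E).famLG i).Sat14 (ζ.C₁ * ζ.B₃ * ε₁) (ζ.C₁ * ε₁) ((βr i).bdry V) U₀ → InUkClassB11 F N i.K i.k ε₀ U →
        Averaging.iter (avOfRecord F N i.K) i.k U = V →
          ∃ U' : ((ζ.withSectE E).famLG i).Pert, ((ζ.withSectE E).famLG i).In18 ε₀ ((βr i).bdry V) U₀ U' ∧ OrbitRel i.k U ((βr i).emb U₀ U') ∧
            (IsCritOfRecord F N i.K i.k V U → ((ζ.withSectE E).famLG i).Crit ((βr i).bdry V) U₀ U'))
    (orbit16 : ∀ (i : ZIdx) (U₀ : ((ζ.withSectE E).famLG i).Cfg) (U₁ : ((ζ.withSectE E).famLG i).Pert) (u u' : ((ζ.withSectE E).famLG i).GT),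
      ((ζ.withSectE E).famLG i).Restricted U₀ u → ((ζ.withSectE E).famLG i).Restricted U₀ u' →
        OrbitRel i.k ((βr i).emb U₀ (((ζ.withSectE E).famLG i).toAxial U₀ U₁ u)) ((βr i).emb U₀ (((ζ.withSectE E).famLG i).toAxial U₀ U₁ u')))
    (leaves : ∀ i, ExistenceLeavesCap (βr i) ζ.B₀ ζ.B₃ ζ.C₁ O₁ O₂ e₅)
    (hB₀ : 0 < ζ.B₀) (hB₁ : 0 < ζ.B₁) (hB₃ : 1 ≤ ζ.B₃) (hC₁L : (F.L : ℝ) ^ 3 ≤ ζ.C₁) (hB₀B₁ : ζ.B₀ ≤ 4 * ζ.B₁)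
    (hc₁ : 0 < ζ.c₁) (hO₁ : 0 < O₁) (hO₂ : 0 < O₂) (he₅ : 0 < e₅)
    (p2 : B11.Prop2Printed ζ.B₁ ζ.B₃ ζ.C₁ ζ.c₁ (ζ.withSectE E).famLG) (p3 : B11.Prop3Printed ζ.C₁ ζ.B₃ ζ.C₂ ζ.C₃ ζ.B₀ ζ.c1h ζ.c₄ ζ.δ₀ (ζ.withSectE E).famLG)
    (p5 : B11.Prop5Printed ζ.B₁ ζ.B₃ ζ.C₁ (ζ.withSectE E).famLG)
    (p8 : B11.Prop8Printed ζ.B₃ (famXOfRecord F N (ζ.withSectEG E G).pinCrit)) (sF : B11.SectFPrinted ζ.B₃ (famXOfRecord F N (ζ.withSectEG E G).pinCrit)) :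
    ∃ w : WorldP, IsRecordOfRecord₁₂CB10YZW F N (datumOfRecord₁₂ F N θ h) w ∧ ∀ P : B12.RunParams, Dag.B11_main (leavesP w P) :=
  exists_record₁₂CB10YZW_b11_main_of_leaf θ h hθ hγ Mstar ops _ lamW
    (b11Leaf_Z11OfRecord_withSectEG_pinCrit_of_towerT_parts_kappa_one ζ E G hC₄ ha₃ hα βr bg hbg14 gaugeFix orbit16 leaves hB₀ hB₁ hB₃ hC₁L hB₀B₁ hc₁
      hO₁ hO₂ he₅ p2 p3 p5 p8 sF)

omit [NeZero N] in
/-- **THE K1′ ∃-FORM IN THE TOWER CURRENCY AT THE TRIPLY-REFINED LAYER**: K0′ at `F` (HYPOTHESIS) + §2's displayed inputs ⇒ SOME ₁₂C record of the given datum is a ₁₂CB10YZW record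
carrying `Dag.B11_main` at every run.  N07 ALONE; NOT a discharge. [cite: Balaban1985Variational, Thm 1 p.279, Sect. A pp.279–280, Props 2–9 pp.281–309; Balaban1989LargeFieldII, Thm 1 + (0.1) pp.355–356 (bookkeeping)] -/
theorem exists_isRecordOfRecord₁₂C_b11_main_withSectEG_pinCrit_of_towerT_parts_kappa_one [NeZero N]
    (hK0 : ∃ (D : Datum F N) (w : WorldP), IsRecordOfRecord₁₂C F N D w) (hC₄ : 0 < E.C₄) (ha₃ : 0 < E.a₃) (hα : 0 < E.α)
    (βr : ∀ i : ZIdx, Bridge (famXOfRecord F N (ζ.withSectEG E G).pinCrit i) ((ζ.withSectE E).famLG i))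
    (bg : ∀ i : ZIdx, GaugeField (F.P i.K) 0 (SU N) → ((ζ.withSectE E).famLG i).Cfg) {O₁ O₂ e₅ : ℝ}
    (hbg14 : ∀ (i : ZIdx) (ε : ℝ) (V : GaugeField (F.P i.K) i.k (SU N)) (U : GaugeField (F.P i.K) 0 (SU N)),
      InUkClassB11 F N i.K i.k (ζ.C₁ * ζ.B₃ * ε) U → Averaging.iter (avOfRecord F N i.K) i.k U = V →
        ((ζ.withSectE E).famLG i).Sat14 (ζ.C₁ * ζ.B₃ * ε) (ζ.C₁ * ε) ((βr i).bdry V) (bg i U))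
    (gaugeFix : ∀ (i : ZIdx) (ε₀ ε₁ : ℝ) (V : GaugeField (F.P i.K) i.k (SU N)) (U₀ : ((ζ.withSectE E).famLG i).Cfg) (U : GaugeField (F.P i.K) 0 (SU N)),
      ((ζ.withSectE E).famLG i).Sat14 (ζ.C₁ * ζ.B₃ * ε₁) (ζ.C₁ * ε₁) ((βr i).bdry V) U₀ → InUkClassB11 F N i.K i.k ε₀ U →
        Averaging.iter (avOfRecord F N i.K) i.k U = V →
          ∃ U' : ((ζ.withSectE E).famLG i).Pert, ((ζ.withSectE E).famLG i).In18 ε₀ ((βr i).bdry V) U₀ U' ∧ OrbitRel i.k U ((βr i).emb U₀ U') ∧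
            (IsCritOfRecord F N i.K i.k V U → ((ζ.withSectE E).famLG i).Crit ((βr i).bdry V) U₀ U'))
    (orbit16 : ∀ (i : ZIdx) (U₀ : ((ζ.withSectE E).famLG i).Cfg) (U₁ : ((ζ.withSectE E).famLG i).Pert) (u u' : ((ζ.withSectE E).famLG i).GT),
      ((ζ.withSectE E).famLG i).Restricted U₀ u → ((ζ.withSectE E).famLG i).Restricted U₀ u' →
        OrbitRel i.k ((βr i).emb U₀ (((ζ.withSectE E).famLG i).toAxial U₀ U₁ u)) ((βr i).emb U₀ (((ζ.withSectE E).famLG i).toAxial U₀ U₁ u')))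
    (leaves : ∀ i, ExistenceLeavesCap (βr i) ζ.B₀ ζ.B₃ ζ.C₁ O₁ O₂ e₅)
    (hB₀ : 0 < ζ.B₀) (hB₁ : 0 < ζ.B₁) (hB₃ : 1 ≤ ζ.B₃) (hC₁L : (F.L : ℝ) ^ 3 ≤ ζ.C₁) (hB₀B₁ : ζ.B₀ ≤ 4 * ζ.B₁)
    (hc₁ : 0 < ζ.c₁) (hO₁ : 0 < O₁) (hO₂ : 0 < O₂) (he₅ : 0 < e₅)
    (p2 : B11.Prop2Printed ζ.B₁ ζ.B₃ ζ.C₁ ζ.c₁ (ζ.withSectE E).famLG) (p3 : B11.Prop3Printed ζ.C₁ ζ.B₃ ζ.C₂ ζ.C₃ ζ.B₀ ζ.c1h ζ.c₄ ζ.δ₀ (ζ.withSectE E).famLG)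
    (p5 : B11.Prop5Printed ζ.B₁ ζ.B₃ ζ.C₁ (ζ.withSectE E).famLG)
    (p8 : B11.Prop8Printed ζ.B₃ (famXOfRecord F N (ζ.withSectEG E G).pinCrit)) (sF : B11.SectFPrinted ζ.B₃ (famXOfRecord F N (ζ.withSectEG E G).pinCrit)) :
    ∃ (D : Datum F N) (w : WorldP), IsRecordOfRecord₁₂C F N D w ∧ IsRecordOfRecord₁₂CB10YZW F N D w ∧ ∀ P : B12.RunParams, Dag.B11_main (leavesP w P) :=
  exists_isRecordOfRecord₁₂C_b11_main_of_leaf F hK0 _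
    (b11Leaf_Z11OfRecord_withSectEG_pinCrit_of_towerT_parts_kappa_one ζ E G hC₄ ha₃ hα βr bg hbg14 gaugeFix orbit16 leaves hB₀ hB₁ hB₃ hC₁L hB₀B₁ hc₁
      hO₁ hO₂ he₅ p2 p3 p5 p8 sF)

end Tower

/-! ## §3 Seat -c's chain currency of Sect. F at the triply-refined layer, and its Stage-12 consumer -/

section Chain

variable (ζ : ResidZ F N) (E : SectEPres F N L η β ζ) (G : SectGPres F N 𝒴 𝒵 ζ)
  (Dc : ∀ i : ZIdx, CubeData (famXOfRecord F N (ζ.withSectEG E G).pinCrit i))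
  {Ec Fc : (i : ZIdx) → (famXOfRecord F N (ζ.withSectEG E G).pinCrit i).Cube → Type} [∀ i c, SeminormedAddCommGroup (Ec i c)] [∀ i c, SeminormedAddCommGroup (Fc i c)]
  {g : ZIdx → B6.Geometry} {d : ℕ} {X : ∀ i : ZIdx, ChainData (famXOfRecord F N (ζ.withSectEG E G).pinCrit i) (Ec i) (Fc i) (g i) d}
  {Y : ∀ i : ZIdx, UnitData (famXOfRecord F N (ζ.withSectEG E G).pinCrit i) (Ec i) (g i)} {δ₀ B₀ B₂ C₂ C₄ S R₁M₁ a₃ a₄ Lc : ℝ}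

/-- **THE [B11] LEAF AT THE TRIPLY-REFINED BUNDLE FROM PROPS 2, 3, 5, 7 AND THE CHAIN DISPLAYS OF SECT. F** (seat -c's `ChainLeaves`∕`UnitLeaves` at per-cube data, `(g i).L = Lc`, [6]
(1.141)–(1.142) at the background 1, locality and gauge invariance of (2), [6] Thm 2 (1.36) whose «critical» IS `Node00.IsCritOfRecord` at this layer) feeding this lineage's
`b11Leaf_Z11OfRecord_pinCrit_of_prop7_chain` (g3; Prop 8 by the halving iteration with the repaired (166′), (169) with `B₄ = 9dL²B₂B₃`, then `B11.thm1_of_prop7_prop8_sectF`) at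
`ζ := ζ.withSectEG E G`, with p4 ∕ p6 ∕ p9 the presentation theorems — NO `hcrit`, NO `hloc`, NO p4 ∕ p6 ∕ p9 binders.  The finest located currency of N07's Sect. F in the tree at the
finest presented layer. [cite: Balaban1985Variational, Thm 1 p.279, Props 2–9 pp.281–309, Prop. 8 p.304, Sect. F (144)–(169) pp.300–305] -/
theorem b11Leaf_Z11OfRecord_withSectEG_pinCrit_of_prop7_chain (hC₄ : 0 < E.C₄) (hEa₃ : 0 < E.a₃) (hα : 0 < E.α) (hgL : ∀ i, (g i).L = Lc)
    (hX : ∀ i, ChainLeaves (famXOfRecord F N (ζ.withSectEG E G).pinCrit i) (X i) δ₀ B₀ ζ.B₁ ζ.B₃ C₂ C₄ S R₁M₁ ζ.c₁ a₃ a₄)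
    (hY : ∀ i, UnitLeaves (famXOfRecord F N (ζ.withSectEG E G).pinCrit i) (X i) (Dc i) (Y i) δ₀ B₀ ζ.c₁)
    (dev1142 : ∀ (i : ZIdx) (U : (famXOfRecord F N (ζ.withSectEG E G).pinCrit i).Cfg) (c : (famXOfRecord F N (ζ.withSectEG E G).pinCrit i).Cube) (e : ℝ),
      (famXOfRecord F N (ζ.withSectEG E G).pinCrit i).Gauged U c → 0 < e → e ≤ 1 →
      (Dc i).normA0 U c < e * tinv (famXOfRecord F N (ζ.withSectEG E G).pinCrit i) c ^ 1 →
      (Dc i).normGradA0 U c < e * tinv (famXOfRecord F N (ζ.withSectEG E G).pinCrit i) c ^ 2 →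
      (Dc i).normLapA0 U c < e * tinv (famXOfRecord F N (ζ.withSectEG E G).pinCrit i) c ^ 3 →
      (Dc i).plaqDev U c < 2 * e + 8 * e ^ 2 ∧ (Dc i).dstarDev U c < e + 36 * (d : ℝ) * e ^ 2 + 50 * (d : ℝ) * e ^ 3)
    (inU_local : ∀ (i : ZIdx) (r : ℝ) (U : (famXOfRecord F N (ζ.withSectEG E G).pinCrit i).Cfg), 0 < r →
      (∀ c : (famXOfRecord F N (ζ.withSectEG E G).pinCrit i).Cube, (famXOfRecord F N (ζ.withSectEG E G).pinCrit i).sizeM c = R₁M₁ →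
        (Dc i).plaqDev U c < r ∧ (Dc i).dstarDev U c < r) →
      (famXOfRecord F N (ζ.withSectEG E G).pinCrit i).InU r U)
    (holder136 : ∀ (i : ZIdx) (ε₀ ε₁ : ℝ) (V : (famXOfRecord F N (ζ.withSectEG E G).pinCrit i).Bdry) (U : (famXOfRecord F N (ζ.withSectEG E G).pinCrit i).Cfg)
      (c : (famXOfRecord F N (ζ.withSectEG E G).pinCrit i).Cube),
      0 < ε₁ → (famXOfRecord F N (ζ.withSectEG E G).pinCrit i).Reg7 ε₁ V → (famXOfRecord F N (ζ.withSectEG E G).pinCrit i).InU ε₀ U →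
      (famXOfRecord F N (ζ.withSectEG E G).pinCrit i).InB V U → (famXOfRecord F N (ζ.withSectEG E G).pinCrit i).IsCritical V U →
      9 * (d : ℝ) * Lc ^ 2 * (famXOfRecord F N (ζ.withSectEG E G).pinCrit i).sizeM c * ε₀ ≤ ζ.c₁ →
      HolderClause ((famXOfRecord F N (ζ.withSectEG E G).pinCrit i).holderA U c) 1
        (B₂ * (ε₀ + (9 * (d : ℝ) * Lc ^ 2 * (famXOfRecord F N (ζ.withSectEG E G).pinCrit i).sizeM c * ε₀ - ε₀)))
        (tinv (famXOfRecord F N (ζ.withSectEG E G).pinCrit i) c))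
    (hd : 1 ≤ d) (hLc : 0 < Lc) (hcB₀ : 0 < B₀) (hB₂ : 0 < B₂) (hC : 0 < C₄ + 4 * C₂) (hR : 1 ≤ R₁M₁) (ha₃ : 0 < a₃) (ha₄ : 0 < a₄)
    (hB₀ : 0 < ζ.B₀) (hB₁ : 0 < ζ.B₁) (hB₃ : 0 < ζ.B₃) (hC₁ : 0 < ζ.C₁) (hc₁ : 0 < ζ.c₁)
    (p2 : B11.Prop2Printed ζ.B₁ ζ.B₃ ζ.C₁ ζ.c₁ (ζ.withSectE E).famLG) (p3 : B11.Prop3Printed ζ.C₁ ζ.B₃ ζ.C₂ ζ.C₃ ζ.B₀ ζ.c1h ζ.c₄ ζ.δ₀ (ζ.withSectE E).famLG)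
    (p5 : B11.Prop5Printed ζ.B₁ ζ.B₃ ζ.C₁ (ζ.withSectE E).famLG) (p7 : B11.Prop7Printed ζ.B₃ ζ.C₁ (famXOfRecord F N (ζ.withSectEG E G).pinCrit)) :
    B11Leaf (Z11OfRecord F N (ζ.withSectEG E G).pinCrit) :=
  b11Leaf_Z11OfRecord_pinCrit_of_prop7_chain (ζ.withSectEG E G) Dc hgL hX hY dev1142 inU_local holder136 hd hLc hcB₀ hB₂ hC hR ha₃ ha₄ hB₁ hB₃ hC₁ hc₁
    p2 p3 (prop4_Z11OfRecord_withSectEG ζ E G hC₄ hEa₃ hB₃ hα hC₁) p5 (prop6_Z11OfRecord_withSectEG ζ E G hB₀ hC₄ hEa₃ hB₃ hα hC₁) p7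
    (prop9_Z11OfRecord_withSectEG ζ E G)

/-- **… AND ITS STAGE-12 CONSUMER**: Props 2, 3, 5, 7 + the chain displays + the three located leaves at `(ζ.withSectEG E G).pinCrit` ⇒ N07 HOLDS at every run of a ₁₂CB10YZW record
over `datumOfRecord₁₂ θ h` presented with that layer (REAL runs modulo K0′; NOT a discharge). [cite: Balaban1985Variational, Thm 1 p.279, Props 2–9 pp.281–309, Sect. F pp.300–305] -/
theorem exists_record₁₂CB10YZW_b11_main_withSectEG_pinCrit_of_prop7_chain (θ : Stage12Params F N) (h : θ.Provisos₁₂ F N) (hθ : θ.Admissible F N)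
    (hγ : 0 < θ.γ) (Mstar : ℕ) (ops : OpsY N θ.toStage3Params Mstar) (lamW : ResidW F N) (hC₄ : 0 < E.C₄) (hEa₃ : 0 < E.a₃) (hα : 0 < E.α)
    (hgL : ∀ i, (g i).L = Lc)
    (hX : ∀ i, ChainLeaves (famXOfRecord F N (ζ.withSectEG E G).pinCrit i) (X i) δ₀ B₀ ζ.B₁ ζ.B₃ C₂ C₄ S R₁M₁ ζ.c₁ a₃ a₄)
    (hY : ∀ i, UnitLeaves (famXOfRecord F N (ζ.withSectEG E G).pinCrit i) (X i) (Dc i) (Y i) δ₀ B₀ ζ.c₁)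
    (dev1142 : ∀ (i : ZIdx) (U : (famXOfRecord F N (ζ.withSectEG E G).pinCrit i).Cfg) (c : (famXOfRecord F N (ζ.withSectEG E G).pinCrit i).Cube) (e : ℝ),
      (famXOfRecord F N (ζ.withSectEG E G).pinCrit i).Gauged U c → 0 < e → e ≤ 1 →
      (Dc i).normA0 U c < e * tinv (famXOfRecord F N (ζ.withSectEG E G).pinCrit i) c ^ 1 →
      (Dc i).normGradA0 U c < e * tinv (famXOfRecord F N (ζ.withSectEG E G).pinCrit i) c ^ 2 →
      (Dc i).normLapA0 U c < e * tinv (famXOfRecord F N (ζ.withSectEG E G).pinCrit i) c ^ 3 →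
      (Dc i).plaqDev U c < 2 * e + 8 * e ^ 2 ∧ (Dc i).dstarDev U c < e + 36 * (d : ℝ) * e ^ 2 + 50 * (d : ℝ) * e ^ 3)
    (inU_local : ∀ (i : ZIdx) (r : ℝ) (U : (famXOfRecord F N (ζ.withSectEG E G).pinCrit i).Cfg), 0 < r →
      (∀ c : (famXOfRecord F N (ζ.withSectEG E G).pinCrit i).Cube, (famXOfRecord F N (ζ.withSectEG E G).pinCrit i).sizeM c = R₁M₁ →
        (Dc i).plaqDev U c < r ∧ (Dc i).dstarDev U c < r) →
      (famXOfRecord F N (ζ.withSectEG E G).pinCrit i).InU r U)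
    (holder136 : ∀ (i : ZIdx) (ε₀ ε₁ : ℝ) (V : (famXOfRecord F N (ζ.withSectEG E G).pinCrit i).Bdry) (U : (famXOfRecord F N (ζ.withSectEG E G).pinCrit i).Cfg)
      (c : (famXOfRecord F N (ζ.withSectEG E G).pinCrit i).Cube),
      0 < ε₁ → (famXOfRecord F N (ζ.withSectEG E G).pinCrit i).Reg7 ε₁ V → (famXOfRecord F N (ζ.withSectEG E G).pinCrit i).InU ε₀ U →
      (famXOfRecord F N (ζ.withSectEG E G).pinCrit i).InB V U → (famXOfRecord F N (ζ.withSectEG E G).pinCrit i).IsCritical V U →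
      9 * (d : ℝ) * Lc ^ 2 * (famXOfRecord F N (ζ.withSectEG E G).pinCrit i).sizeM c * ε₀ ≤ ζ.c₁ →
      HolderClause ((famXOfRecord F N (ζ.withSectEG E G).pinCrit i).holderA U c) 1
        (B₂ * (ε₀ + (9 * (d : ℝ) * Lc ^ 2 * (famXOfRecord F N (ζ.withSectEG E G).pinCrit i).sizeM c * ε₀ - ε₀)))
        (tinv (famXOfRecord F N (ζ.withSectEG E G).pinCrit i) c))
    (hd : 1 ≤ d) (hLc : 0 < Lc) (hcB₀ : 0 < B₀) (hB₂ : 0 < B₂) (hC : 0 < C₄ + 4 * C₂) (hR : 1 ≤ R₁M₁) (ha₃ : 0 < a₃) (ha₄ : 0 < a₄)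
    (hB₀ : 0 < ζ.B₀) (hB₁ : 0 < ζ.B₁) (hB₃ : 0 < ζ.B₃) (hC₁ : 0 < ζ.C₁) (hc₁ : 0 < ζ.c₁)
    (p2 : B11.Prop2Printed ζ.B₁ ζ.B₃ ζ.C₁ ζ.c₁ (ζ.withSectE E).famLG) (p3 : B11.Prop3Printed ζ.C₁ ζ.B₃ ζ.C₂ ζ.C₃ ζ.B₀ ζ.c1h ζ.c₄ ζ.δ₀ (ζ.withSectE E).famLG)
    (p5 : B11.Prop5Printed ζ.B₁ ζ.B₃ ζ.C₁ (ζ.withSectE E).famLG) (p7 : B11.Prop7Printed ζ.B₃ ζ.C₁ (famXOfRecord F N (ζ.withSectEG E G).pinCrit)) :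
    ∃ w : WorldP, IsRecordOfRecord₁₂CB10YZW F N (datumOfRecord₁₂ F N θ h) w ∧ ∀ P : B12.RunParams, Dag.B11_main (leavesP w P) :=
  exists_record₁₂CB10YZW_b11_main_of_leaf θ h hθ hγ Mstar ops _ lamW
    (b11Leaf_Z11OfRecord_withSectEG_pinCrit_of_prop7_chain ζ E G Dc hC₄ hEa₃ hα hgL hX hY dev1142 inU_local holder136 hd hLc hcB₀ hB₂ hC hR ha₃ ha₄
      hB₀ hB₁ hB₃ hC₁ hc₁ p2 p3 p5 p7)

end Chain

/-! ## §4 Census ∕ honesty at the triply-refined layer -/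

section Census

variable (F) (L η β 𝒴 𝒵)

/-- **THE JUNK CHANNEL OF THE ∀-FORM SURVIVES ALL THREE REFINEMENTS** (census; `Node00.exists_withSectEG_not_b11Leaf` one refinement up, same witness): a residual layer whose
regularity data of (9)–(10) never say «gauged» (one cube of size parameter `0` per member) — constants `B₀ := 0`, `B₃ := 4L`, `C₁ := 1`, `δ₀ := 0`, `B₅ := 4` so that it carries BOTH
presentations (def-B11's flat Sect.-E stratum, `Node00.zeroSectGPres`) — makes the leaf at `(ζ.withSectEG E G).pinCrit` FAIL through `t1` (Theorem 1 at the member `K = k = 0`, `V := 1`,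
n07-a's `reg7_one`), whatever the printed statements: the pin of «critical» and the two presentations do not touch `R`.  So N07 is NOT bookable in ∀-form over a record exposing this
layer either; the object-level pin of `R` (F8 — node00-def-B11 g4's `CarriersZRegPin`, INTENT-1 2026-08-27) is what closes the channel. [cite: Balaban1985Variational, Thm 1 (9)–(10) p.279 (bookkeeping: the typed regularity clause reads the residual data)] -/
theorem exists_withSectEG_pinCrit_not_b11Leaf :
    ∃ (ζ : ResidZ F N) (E : SectEPres F N L η β ζ) (G : SectGPres F N 𝒴 𝒵 ζ), ¬ B11Leaf (Z11OfRecord F N (ζ.withSectEG E G).pinCrit) := by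
  let Rbad : ∀ K : ℕ, B11Thm1CarrierT.RegCarrierT F N K := fun _ =>
    ⟨PUnit, fun _ => 0, fun _ => 0, fun _ _ => False, fun _ _ => 0, fun _ _ => 0, fun _ _ _ => 0, fun _ _ => 0⟩
  let ζ₀ : ResidZ F N := Classical.choice (nonempty_residZ F N)
  let ζ : ResidZ F N := { ζ₀ with R := fun i => Rbad i.K, B₀ := 0, B₃ := 4 * L, C₁ := 1, δ₀ := 0, B₅ := 4 }
  have hE : Nonempty (SectEPres F N L η β ζ) := exists_sectEPres ζ le_rfl le_rfl
  refine ⟨ζ, Classical.choice hE, zeroSectGPres ζ one_pos le_rfl le_rfl, fun hZ => ?_⟩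
  obtain ⟨C, hC⟩ := exists_thm1At_of_b11Leaf_Z11OfRecord hZ
  obtain ⟨h8, -, h910⟩ :=
    hC ⟨0, 0, le_rfl⟩ C.a₁ C.a₁_pos le_rfl (1 : GaugeField (F.P 0) 0 (SU N)) (B11Thm1CarrierT.reg7_one (Rbad 0) C.a₁_pos)
  obtain ⟨U, -, -, hU⟩ := h8
  exact (h910 U hU PUnit.unit (C.Mfun_pos C.a₁ C.a₁_pos).le).1

end Census

omit [NeZero N] in
/-- **HONESTY SENTENCE OWED TO ref-C READ-121 NOTE 1 (on this lineage's criticality predicate, p464601)**: the curve form `Node00.IsCritOfRecord F N K k V U` is VACUOUSLY TRUE OFF THE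
CONSTRAINT MANIFOLD 𝔅_k(V) — if `Ū^k(U) ≠ V` no curve through `U` lies in 𝔅_k(V) near `t = 0`, so the defining implication has a false premise.  Harmless by design: every consumer
of «critical» in the [B11] group (`B11.VarProblemX.Laws`, Props 7 (i), 8, Sect. F, the bridge clause (18)) reads it TOGETHER WITH `InB V U` (`Ū^k(U) = V`); recorded so that no one
feeds `IsCritOfRecord` alone. [cite: Balaban1985Variational, (3), (5)–(6) p.278, Prop. 7 p.299 (bookkeeping: the domain of the criticality notion)] -/
theorem isCritOfRecord_of_iter_ne [NeZero N] {K k : ℕ} {V : GaugeField (F.P K) k (SU N)} {U : GaugeField (F.P K) 0 (SU N)}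
    (h : Averaging.iter (avOfRecord F N K) k U ≠ V) : IsCritOfRecord F N K k V U := by
  intro γ hγ0 _ hev
  have h0 : Averaging.iter (avOfRecord F N K) k (γ 0) = V := hev.self_of_nhds
  rw [hγ0] at h0
  exact absurd h0 h

end Summit.QuantumFields.YangMills.BalabanUVNodes.N07AtRecordSectGPinned

end
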